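import Summits.KontsevichZagierPeriods.KontsevichZagierPeriods.Theorems.LinRedNormalFormArrangementNormalFormSeparateThreeHICone

/-!
# Dilations, translations, cubes and transversal points in `(Fin 2 → ℝ) × ℝ`

(Line `janus-bands`, crux `ArrangementNormalForm`, stub `stub_separateThreeZero`, part `HIScaling`
of the termwise numerator split `separateThree_hI` under the rim condition.)

Measure-theoretic and elementary-geometric tools for the LOWER POWER BOUND at a rim vertex on the
pole plane (part `HILower`): Lebesgue measure on `(Fin 2 → ℝ) × ℝ` is an additive Haar measure
(`isAddHaarMeasure_volume3`), so set integrals scale by `λ³` under the dilation `p ↦ λ • p`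
(`setIntegral_dilate`, registered as `separateThree_scaling`) and integrability is invariant under
translations (`integrableOn_translate`); cubes `cube q c` in the sup norm and their dilates
(`smul_cube`); and the existence, in any open set, of points off finitely many planes
`{p | κⱼ · p.1 = 0}` through the vertical axis (`exists_transversal_point`).
-/

noncomputable section

open Set MeasureTheory Filter Topology
open scoped Pointwise

namespace Summit.KontsevichZagierPeriods.ArrangementNormalForm.JanusBands

namespace SepThree

/-! ### Haar measure, dilations and translations -/

/-- Lebesgue measure on `(Fin 2 → ℝ) × ℝ` is an additive Haar measure. -/
theorem isAddHaarMeasure_volume3 : (volume : Measure ((Fin 2 → ℝ) × ℝ)).IsAddHaarMeasure := by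
  rw [show (volume : Measure ((Fin 2 → ℝ) × ℝ)) = (volume : Measure (Fin 2 → ℝ)).prod volume from rfl]
  infer_instance

/-- **Set integrals scale by `λ³` under dilations.** -/
theorem setIntegral_dilate (s : Set ((Fin 2 → ℝ) × ℝ)) (f : (Fin 2 → ℝ) × ℝ → ℝ) {c : ℝ}
    (hc : 0 < c) : ∫ x in c • s, f x = c ^ 3 * ∫ x in s, f (c • x) := by
  haveI := isAddHaarMeasure_volume3
  have h := Measure.setIntegral_comp_smul_of_pos volume f s hc
  have h3 : Module.finrank ℝ ((Fin 2 → ℝ) × ℝ) = 3 := by simp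
  rw [h3, smul_eq_mul] at h
  rw [h, ← mul_assoc, mul_inv_cancel₀ (pow_ne_zero 3 hc.ne'), one_mul]

/-- **Integrability is invariant under translations.** -/
theorem integrableOn_translate {f : (Fin 2 → ℝ) × ℝ → ℝ} {s : Set ((Fin 2 → ℝ) × ℝ)}
    (hf : IntegrableOn f s) (a : (Fin 2 → ℝ) × ℝ) :
    IntegrableOn (fun p => f (a + p)) {p | a + p ∈ s} := by
  haveI := isAddHaarMeasure_volume3
  have hmp : MeasurePreserving (fun p : (Fin 2 → ℝ) × ℝ => a + p) volume volume :=
    measurePreserving_add_left volume a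
  have hemb : MeasurableEmbedding (fun p : (Fin 2 → ℝ) × ℝ => a + p) :=
    (Homeomorph.addLeft a).measurableEmbedding
  exact (hmp.integrableOn_comp_preimage hemb).2 hf

/-! ### Cubes -/

/-- The closed cube of half-width `c` around `q` in the sup norm. -/
def cube (q : (Fin 2 → ℝ) × ℝ) (c : ℝ) : Set ((Fin 2 → ℝ) × ℝ) :=
  Icc (q - ((fun _ => c), c)) (q + ((fun _ => c), c))

/-- Membership in a cube, coordinatewise. -/
theorem mem_cube_iff {q : (Fin 2 → ℝ) × ℝ} {c : ℝ} {p : (Fin 2 → ℝ) × ℝ} :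
    p ∈ cube q c ↔ (∀ i, |p.1 i - q.1 i| ≤ c) ∧ |p.2 - q.2| ≤ c := by
  simp only [cube, mem_Icc, Prod.le_def, Pi.le_def, Prod.fst_sub, Prod.snd_sub, Prod.fst_add,
    Prod.snd_add, Pi.sub_apply, Pi.add_apply, abs_le]
  constructor
  · rintro ⟨⟨h1, h2⟩, ⟨h3, h4⟩⟩
    exact ⟨fun i => ⟨by linarith [h1 i], by linarith [h3 i]⟩, ⟨by linarith, by linarith⟩⟩
  · rintro ⟨h1, h2⟩
    exact ⟨⟨fun i => by linarith [(h1 i).1], by linarith [h2.1]⟩,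
      ⟨fun i => by linarith [(h1 i).2], by linarith [h2.2]⟩⟩

/-- Points of a cube are close to its centre in the sup norm. -/
theorem norm_sub_le_of_mem_cube {q : (Fin 2 → ℝ) × ℝ} {c : ℝ} (hc : 0 ≤ c) {p : (Fin 2 → ℝ) × ℝ}
    (hp : p ∈ cube q c) : ‖p - q‖ ≤ c := by
  obtain ⟨h1, h2⟩ := mem_cube_iff.1 hp
  rw [Prod.norm_def, max_le_iff]
  refine ⟨(pi_norm_le_iff_of_nonneg hc).2 fun i => ?_, ?_⟩
  · rw [Real.norm_eq_abs]; exact h1 i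
  · rw [Real.norm_eq_abs]; exact h2

/-- The centre belongs to its cube. -/
theorem mem_cube_self (q : (Fin 2 → ℝ) × ℝ) {c : ℝ} (hc : 0 ≤ c) : q ∈ cube q c := by
  rw [mem_cube_iff]; simp [hc]

/-- A cube is compact. -/
theorem isCompact_cube (q : (Fin 2 → ℝ) × ℝ) (c : ℝ) : IsCompact (cube q c) := isCompact_Icc

/-- A cube is measurable. -/
theorem measurableSet_cube (q : (Fin 2 → ℝ) × ℝ) (c : ℝ) : MeasurableSet (cube q c) := measurableSet_Icc

/-- **Dilates of cubes are cubes.** -/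
theorem smul_cube (q : (Fin 2 → ℝ) × ℝ) (c : ℝ) {s : ℝ} (hs : 0 < s) :
    s • cube q c = cube (s • q) (s * c) := by
  ext p
  rw [Set.mem_smul_set_iff_inv_smul_mem₀ hs.ne', mem_cube_iff, mem_cube_iff]
  simp only [Prod.smul_fst, Prod.smul_snd, Pi.smul_apply, smul_eq_mul]
  have key : ∀ x y : ℝ, |s⁻¹ * x - y| ≤ c ↔ |x - s * y| ≤ s * c := fun x y => by
    rw [show s⁻¹ * x - y = s⁻¹ * (x - s * y) by field_simp, abs_mul, abs_of_pos (inv_pos.2 hs),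
      inv_mul_le_iff₀ hs]
  simp only [key]

/-- Membership in a dilated cube. -/
theorem mem_smul_cube_iff {q : (Fin 2 → ℝ) × ℝ} {c s : ℝ} (hs : 0 < s) {p : (Fin 2 → ℝ) × ℝ} :
    p ∈ cube (s • q) (s * c) ↔ ∃ p₁ ∈ cube q c, p = s • p₁ := by
  rw [← smul_cube q c hs, Set.mem_smul_set]
  constructor
  · rintro ⟨p₁, hp₁, rfl⟩; exact ⟨p₁, hp₁, rfl⟩
  · rintro ⟨p₁, hp₁, rfl⟩; exact ⟨p₁, hp₁, rfl⟩

/-! ### Transversal points -/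

/-- A direction in the base plane off finitely many lines through the origin. -/
theorem exists_transversal_dir {m : ℕ} (κ : Fin m → Fin 2 → ℝ) (B : Finset (Fin m))
    (hκ : ∀ j ∈ B, κ j ≠ 0) : ∃ w : Fin 2 → ℝ, ∀ j ∈ B, κ j 0 * w 0 + κ j 1 * w 1 ≠ 0 := by
  obtain ⟨s, hs⟩ := Infinite.exists_notMem_finset (B.image fun j => -(κ j 0) / κ j 1)
  refine ⟨![1, s], fun j hj h => ?_⟩
  simp only [Matrix.cons_val_zero, Matrix.cons_val_one, mul_one] at h
  by_cases h1 : κ j 1 = 0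
  · have h0 : κ j 0 = 0 := by rw [h1, zero_mul, add_zero] at h; exact h
    exact hκ j hj (funext fun i => by fin_cases i <;> assumption)
  · apply hs
    rw [Finset.mem_image]
    refine ⟨j, hj, ?_⟩
    field_simp
    linarith

/-- **Transversal points.** Every open neighbourhood of a point contains a nearby point off the
finitely many planes `{p | κⱼ 0 · p.1 0 + κⱼ 1 · p.1 1 = 0}`, `κⱼ ≠ 0`. -/
theorem exists_transversal_point {m : ℕ} (κ : Fin m → Fin 2 → ℝ) (B : Finset (Fin m))
    (hκ : ∀ j ∈ B, κ j ≠ 0) {U : Set ((Fin 2 → ℝ) × ℝ)} (hU : IsOpen U) {p : (Fin 2 → ℝ) × ℝ}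
    (hp : p ∈ U) {ε : ℝ} (hε : 0 < ε) :
    ∃ p' ∈ U, ‖p' - p‖ < ε ∧ ∀ j ∈ B, κ j 0 * p'.1 0 + κ j 1 * p'.1 1 ≠ 0 := by
  obtain ⟨w, hw⟩ := exists_transversal_dir κ B hκ
  obtain ⟨ρ, hρ, hball⟩ := Metric.isOpen_iff.1 hU p hp
  set W : (Fin 2 → ℝ) × ℝ := (w, 0) with hW
  -- the exceptional parameters
  set σbad : Finset ℝ := B.image fun j => -(κ j 0 * p.1 0 + κ j 1 * p.1 1) / (κ j 0 * w 0 + κ j 1 * w 1)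
    with hσbad
  set σmax : ℝ := min ρ ε / (‖W‖ + 1) with hσmax_def
  have hσmax : 0 < σmax := by positivity
  obtain ⟨σ, hσ, hσn⟩ := (Ioo_infinite hσmax).exists_notMem_finset σbad
  refine ⟨p + σ • W, hball ?_, ?_, fun j hj h => hσn ?_⟩
  · rw [Metric.mem_ball, dist_eq_norm, add_sub_cancel_left, norm_smul, Real.norm_eq_abs, abs_of_pos hσ.1]
    calc σ * ‖W‖ ≤ σmax * ‖W‖ := mul_le_mul_of_nonneg_right hσ.2.le (norm_nonneg _)
      _ < min ρ ε := by
          rw [hσmax_def, div_mul_eq_mul_div, div_lt_iff₀ (by positivity)]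
          nlinarith [lt_min hρ hε, norm_nonneg W]
      _ ≤ ρ := min_le_left _ _
  · rw [add_sub_cancel_left, norm_smul, Real.norm_eq_abs, abs_of_pos hσ.1]
    calc σ * ‖W‖ ≤ σmax * ‖W‖ := mul_le_mul_of_nonneg_right hσ.2.le (norm_nonneg _)
      _ < min ρ ε := by
          rw [hσmax_def, div_mul_eq_mul_div, div_lt_iff₀ (by positivity)]
          nlinarith [lt_min hρ hε, norm_nonneg W]
      _ ≤ ε := min_le_right _ _
  · rw [hσbad, Finset.mem_image]
    refine ⟨j, hj, ?_⟩
    have hwj := hw j hj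
    simp only [hW, Prod.fst_add, Prod.smul_fst, Pi.add_apply, Pi.smul_apply, smul_eq_mul] at h
    field_simp
    linarith

end SepThree

/-- **Set integrals scale by `λ³` under dilations of `(Fin 2 → ℝ) × ℝ`** (registered part of
`stub_separateThreeZero`; literal form of `SepThree.setIntegral_dilate`): for `0 < c`,
`∫_{c • s} f = c³ ∫_s f (c • x) dx` for Lebesgue measure on `(Fin 2 → ℝ) × ℝ`. -/
theorem separateThree_scaling (s : Set ((Fin 2 → ℝ) × ℝ)) (f : (Fin 2 → ℝ) × ℝ → ℝ) (c : ℝ) (hc : 0 < c) : ∫ x in c • s, f x = c ^ 3 * ∫ x in s, f (c • x) := by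
  exact SepThree.setIntegral_dilate s f hc

end Summit.KontsevichZagierPeriods.ArrangementNormalForm.JanusBands
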